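import Summits.BirchSwinnertonDyer.BirchSwinnertonDyer.Theorems.AdditiveKolyvaginRoadManinFrameResidueProperRTameTwistFull57
import HarnessLib

/-!
# Crux `ManinDatumSupercuspidalCMInert` (stmt-BirchSwinnertonDyer-20111, BED r605): the tame-twist Manin lever at
# `p ∈ {5, 7}` run POINTWISE — from the curve's own ODD prime-modulus twisted symbol sums, no named fact

Route `BiquadraticEisensteinDescent` (cell `pub/bsd-wall`, width seat `bsd-wall-cm-bed-w4` g10; `--supports`
stmt-BirchSwinnertonDyer-20111, helper). THEOREMS ONLY (no definition, no named fact, no `sorry`); nothing is closed by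
this file and BSD is not proved by any of it.

Seat `bsd-wall-manin-p1` g3/g4's tame-twist lever (`…ManinFrameResidueProperRTameTwistSymbols57` /
`…Full57`: `pint_im_cuspSymbol57`, `not_dvd_c_of_tameTwist57`) derives `p ∤ c(D)` at a lattice-optimal datum from the
Literature NAMED FACT `kato_neron_isIntegral_twistedSymbolSum_of_additive_five_le` (Kato's zeta elements in Néron units,
a derived reading of Kato 2004 + Kim–Nakamura + Kosters–Pannekoek, XL, unproved). Reading that proof shows the fact is
consumed at ONE place (`pint_twistedSymbolSum_div57`) and ONLY for:

* the curve `W` itself and the newform `f` of the datum,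
* ODD Dirichlet characters `χ` of PRIME modulus `d′` with `N < d′`, `d′ ≡ 3 (mod 4)`, `p ∤ d′ − 1`, `r ∤ d′ − 1` for
  the odd primes `r ∣ p − 1`, and `p` a square mod `d′` (the auxiliary primes of the Dirichlet step
  `exists_prime_eq_add_mul_of_adjustableL`).

This file re-runs the lever with exactly those instances as a HYPOTHESIS (`hKodd`, stated directly as the
`p`-integrality of `Σ_a χ(a){∞, a/d′}_f / (|Ω⁻(W)| i)`), so that no Euler-factor bookkeeping, no `Addv`/`Irr` input and
no Kosters–Pannekoek clause (`W(ℚ_p)[p] = 0`) is needed at this level — they were hypotheses OF THE FACT, not of the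
lever:

* `pint_im_cuspSymbol_of_adjustable_of_oddPrimeInstances` — one L-adjustable `γ` with `−d_γ` a square mod `p`
  (= `pint_im_cuspSymbol_of_adjustable57` with the `hK` call swapped for `hKodd`; any prime `p ≠ 2`, `p ∣ N`);
* `pint_im_cuspSymbol_of_oddPrimeInstances57` — every `γ ∈ Γ₀(N)` at `p ∈ {5, 7}` (= `pint_im_cuspSymbol57`, the
  57-splitting `exists_eq_mul_adjustable57` with no resonant primes to control);
* `not_dvd_c_of_oddPrimeInstances57` — **`p ∤ c(D)` at every lattice-optimal `X₀(N)`-datum `D` of `W`, `p ∈ {5, 7}`,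
  `p ∣ N`, from the odd prime-modulus instances for `D.f` alone** (= `not_dvd_c_of_tameTwist57`).

The companion `…ManinDatumSupercuspidalCMInertOfPlainOddInstances` specialises to BED's CM cells (stubs `stub_S5`,
`stub_S7`), where the target instances are classical CM twisted `L`-values — the `p ∈ {5, 7}` twin of what
`…InertBadAtThreeOddPrimeInstances` (p626343) did at `p = 3` for crux `InertBadAtThree`.

References: [Manin1972] Prop. 1.4 / Thm. 1.6; [Mazur1978] §6 Prop. 6.3 (1); [Kato2004Asterisque] Thm. 9.7 (the shape of
the instances); [EdixhovenManin1991] §1.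
-/

set_option autoImplicit false
-- single-conjunct summit: `Summit.BirchSwinnertonDyer.BirchSwinnertonDyer.…` repeats the name by design (D-0017)
set_option linter.dupNamespace false

noncomputable section

open scoped Classical MatrixGroups

open WeierstrassCurve NumberField Literature.NumberTheory.EllipticCurves
  Literature.NumberTheory.EllipticCurves.ModularForms
  Literature.NumberTheory.EllipticCurves.Rank1Residual
  Literature.NumberTheory.DiophantineGeometry IsDedekindDomain Rat.HeightOneSpectrum
  Summit.BirchSwinnertonDyer.Rank1Residual Summit.BirchSwinnertonDyer.Rank1Residual.Additive
  CongruenceSubgroup Complex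

namespace Summit.BirchSwinnertonDyer.BirchSwinnertonDyer.Theorems.BiquadraticEisensteinDescentManinDatumSupercuspidalCMInertPointwiseLever

open Summit.BirchSwinnertonDyer.BirchSwinnertonDyer.Theorems.ManinFrameResidueProperRTameTwist

section Symbols

variable {W : WeierstrassCurve ℚ} [W.IsElliptic] {N : ℕ} [NeZero N] {p : ℕ} [hp : Fact p.Prime]

/-- **One L-adjustable `γ`, from the odd prime-modulus instances.** Let `W/ℚ` be elliptic with a newform `f` at a
level `N`, `p ≠ 2` a prime with `p ∣ N`, and suppose (`hKodd`) that for every prime `d′ > N` with `d′ ≡ 3 (mod 4)`,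
`p ∤ d′ − 1`, `r ∤ d′ − 1` (odd primes `r ∣ p − 1`) and `p` a square mod `d′` (or `p > 7`), and every ODD character
`χ (mod d′)`, the twisted symbol sum `Σ_a χ(a){∞, a/d′}_f / (|Ω⁻(W)| i)` is `p`-integral. Then for `γ = (a b; c d) ∈ Γ₀(N)`
with `c ≠ 0`, `p ∤ d − 1`, `r ∤ d − 1` for odd `r ∣ p − 1` with `r ∣ c`, `4 ∣ c → d ≡ 3 (4)`, and `−d` a square mod `p`
(or `p > 7`): `Im {∞, γ∞}_f / |Ω⁻(W)|` is `p`-integral. Proof = seat manin-p1's `pint_im_cuspSymbol_of_adjustable57`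
verbatim (Dirichlet prime `d′ = d + kc` transporting the residue of `p`, Manin's `{∞, b′/d′} = {∞, γ∞} + {∞, 0}`, odd-character
Fourier inversion `two_mul_sum_odd_twistedSymbolSum`, `p ∤ d′ − 1`), with the single call of the named fact replaced
by `hKodd`. [cite: Manin1972, Prop. 1.4 / Thm. 1.6] -/
theorem pint_im_cuspSymbol_of_adjustable_of_oddPrimeInstances (hp2 : p ≠ 2) (f : CuspForm (Gamma0 N) 2)
    (hf : IsNewformOf W f) (hpN : p ∣ N)
    (hKodd : ∀ (d' : ℕ) [NeZero d'], d'.Prime → N < d' → ¬ p ∣ d' - 1 →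
      (∀ r : ℕ, r.Prime → r ≠ 2 → r ∣ p - 1 → ¬ r ∣ d' - 1) → ¬ 4 ∣ d' - 1 →
      (7 < p ∨ IsSquare ((p : ZMod d'))) →
      ∀ χ : DirichletCharacter ℂ d', χ.Odd →
        ∃ s : ℕ, ¬ p ∣ s ∧ IsIntegral ℤ ((s : ℂ) *
          (twistedSymbolSum f χ / ((W.imaginaryPeriodRat : ℂ) * I))))
    (γ : Gamma0 N) (hc : (γ : SL(2, ℤ)) 1 0 ≠ 0) (hdp : ¬ (p : ℤ) ∣ (γ : SL(2, ℤ)) 1 1 - 1)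
    (hdr : ∀ r : ℕ, r.Prime → r ≠ 2 → r ∣ p - 1 → (r : ℤ) ∣ (γ : SL(2, ℤ)) 1 0 →
      ¬ (r : ℤ) ∣ (γ : SL(2, ℤ)) 1 1 - 1)
    (h4γ : (4 : ℤ) ∣ (γ : SL(2, ℤ)) 1 0 → (4 : ℤ) ∣ (γ : SL(2, ℤ)) 1 1 - 3)
    (hγp : 7 < p ∨ IsSquare (-((((γ : SL(2, ℤ)) 1 1 : ℤ)) : ZMod p))) :
    ∃ s : ℕ, ¬ p ∣ s ∧ IsIntegral ℤ ((s : ℂ) *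
      ((((cuspSymbol f γ).im : ℝ) : ℂ) / (W.imaginaryPeriodRat : ℂ))) := by
  have hpP : p.Prime := hp.out
  have hreal : ∀ n, (cuspCoeff f n).im = 0 := cuspCoeff_im_eq_zero_of_coeffField_eq_bot hf.coeffField_eq_bot
  have hB : ∀ ℓ ∈ ({p} : Finset ℕ), ℓ.Prime ∧ ℓ ≠ 2 ∧ ℓ ∣ N := fun ℓ hℓ ↦ by
    rw [Finset.mem_singleton] at hℓ
    subst hℓ
    exact ⟨hpP, hp2, hpN⟩
  obtain ⟨k, d', hd', hNd', hd'eq, hpd', hrd', h4d', hsq⟩ :=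
    exists_prime_eq_add_mul_of_adjustableL hpP hpN γ hc hdp hdr h4γ {p} hB
  haveI : NeZero d' := ⟨hd'.ne_zero⟩
  -- `p` is a square mod `d′` (from `−d_γ` a square mod `p`), unless `p > 7`
  have hsqp : 7 < p ∨ IsSquare ((p : ZMod d')) := by
    rcases hγp with h | h
    · exact Or.inl h
    · exact Or.inr ((hsq p (Finset.mem_singleton_self p)).1 h)
  -- `δ = γ T^k`: same first column, lower-right entry `d′`
  set δ : Gamma0 N := γ * ⟨ModularGroup.T ^ k, Literature.NumberTheory.Automorphic.T_zpow_mem_Gamma0 k⟩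
    with hδdef
  obtain ⟨h00, h10, h01, h11⟩ := entries_mul_T_zpow (γ : SL(2, ℤ)) k
  have hδ : (δ : SL(2, ℤ)) = (γ : SL(2, ℤ)) * ModularGroup.T ^ k := rfl
  have hd11 : ((δ : SL(2, ℤ)) 1 1 : ℤ) = d' := by rw [hδ, h11, hd'eq]; ring
  have hcs : cuspSymbol f δ = cuspSymbol f γ := by
    simp only [cuspSymbol, hδ, h00, h10]
  obtain ⟨b', hb'def⟩ : ∃ b' : ℤ, b' = (δ : SL(2, ℤ)) 0 1 := ⟨_, rfl⟩
  -- Manin: `{∞, b′/d′} = {∞, δ∞} + {∞, 0}`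
  have hne : (((δ : SL(2, ℤ)) 1 0 : ℤ) : ℚ) * 0 + (((δ : SL(2, ℤ)) 1 1 : ℤ) : ℚ) ≠ 0 := by
    rw [mul_zero, zero_add, hd11]; exact_mod_cast hd'.ne_zero
  have hM := modularSymbol_gamma0_smul_holds f δ 0 hne
  rw [mul_zero, zero_add, mul_zero, zero_add, hd11, hcs, ← hb'def, Int.cast_natCast] at hM
  -- `b′` is a unit mod `d′`
  have hbu : IsUnit ((b' : ZMod d')) := by
    rw [ZMod.coe_int_isUnit_iff_isCoprime]
    refine ⟨(δ : SL(2, ℤ)) 0 0, -(δ : SL(2, ℤ)) 1 0, ?_⟩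
    have hdet := entry_det δ
    rw [hd11, ← hb'def] at hdet
    linear_combination hdet
  -- the odd-character identity, divided by `|Ω⁻| i`
  have hid := two_mul_sum_odd_twistedSymbolSum hd' f hreal b' hbu
  rw [hM, Complex.sub_conj] at hid
  -- each summand divided by `Ω i` is `p`-integral: THIS is where the pointwise instances replace the named fact
  have hsum : ∃ s : ℕ, ¬ p ∣ s ∧ IsIntegral ℤ ((s : ℂ) *
      ∑ χ ∈ (Finset.univ : Finset (DirichletCharacter ℂ d')) with χ.Odd,
        χ ((b' : ZMod d'))⁻¹ * (twistedSymbolSum f χ / ((W.imaginaryPeriodRat : ℂ) * I))) := by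
    refine pint_sum hpP _ _ fun χ hχ ↦ pint_mul hpP (pint_of_isIntegral hpP (isIntegral_apply hd' χ _)) ?_
    exact hKodd d' hd' hNd' hpd' hrd' h4d' hsqp χ (Finset.mem_filter.mp hχ).2
  -- rewrite the sum as `(d′−1) · Im/Ω`
  have hsum_eq : ∑ χ ∈ (Finset.univ : Finset (DirichletCharacter ℂ d')) with χ.Odd,
      χ ((b' : ZMod d'))⁻¹ * (twistedSymbolSum f χ / ((W.imaginaryPeriodRat : ℂ) * I)) =
      ((d' - 1 : ℕ) : ℂ) * ((((cuspSymbol f γ + modularSymbol f 0).im : ℝ) : ℂ) /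
        (W.imaginaryPeriodRat : ℂ)) := by
    have h2 : (2 : ℂ) ≠ 0 := two_ne_zero
    have hΩ0 : (W.imaginaryPeriodRat : ℂ) ≠ 0 := by exact_mod_cast W.imaginaryPeriodRat_pos.ne'
    simp_rw [← mul_div_assoc, ← Finset.sum_div]
    rw [show ∑ χ ∈ (Finset.univ : Finset (DirichletCharacter ℂ d')) with χ.Odd,
        χ ((b' : ZMod d'))⁻¹ * twistedSymbolSum f χ =
        ((d' - 1 : ℕ) : ℂ) * ((2 * (cuspSymbol f γ + modularSymbol f 0).im : ℝ) : ℂ) * I / 2 by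
      rw [eq_div_iff h2, mul_comm _ (2 : ℂ), hid]; ring]
    push_cast
    field_simp
  rw [hsum_eq] at hsum
  have him0 : (modularSymbol f 0).im = 0 := by
    have := modularSymbol_neg_eq_conj_holds f hreal 0
    rw [neg_zero] at this
    exact Complex.conj_eq_iff_im.mp this.symm
  rw [Complex.add_im, him0, add_zero] at hsum
  exact pint_of_pint_natCast_mul hpP hpd' hsum

/-- **Every `γ ∈ Γ₀(N)` at `p ∈ {5, 7}`, from the odd prime-modulus instances**: under `hKodd` (as in
`pint_im_cuspSymbol_of_adjustable_of_oddPrimeInstances`) and `p ∣ N`, `Im {∞, γ∞}_f / |Ω⁻(W)|` is `p`-integral for EVERY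
`γ ∈ Γ₀(N)` — `γ⁴ = γ₁ γ₂` with adjustable `γᵢ` whose `−d_{γᵢ}` are squares mod `p` (seat manin-p1's 57-splitting
`exists_eq_mul_adjustable57`, here with no resonant prime to control), `{∞, ·∞}_f` a homomorphism, `p ∤ 4`. Proof =
`pint_im_cuspSymbol57` verbatim with the named fact replaced by `hKodd`. [cite: Manin1972, Prop. 1.4 / Thm. 1.6] -/
theorem pint_im_cuspSymbol_of_oddPrimeInstances57 (hp57 : p = 5 ∨ p = 7) (f : CuspForm (Gamma0 N) 2)
    (hf : IsNewformOf W f) (hpN : p ∣ N)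
    (hKodd : ∀ (d' : ℕ) [NeZero d'], d'.Prime → N < d' → ¬ p ∣ d' - 1 →
      (∀ r : ℕ, r.Prime → r ≠ 2 → r ∣ p - 1 → ¬ r ∣ d' - 1) → ¬ 4 ∣ d' - 1 →
      (7 < p ∨ IsSquare ((p : ZMod d'))) →
      ∀ χ : DirichletCharacter ℂ d', χ.Odd →
        ∃ s : ℕ, ¬ p ∣ s ∧ IsIntegral ℤ ((s : ℂ) *
          (twistedSymbolSum f χ / ((W.imaginaryPeriodRat : ℂ) * I))))
    (γ : Gamma0 N) :
    ∃ s : ℕ, ¬ p ∣ s ∧ IsIntegral ℤ ((s : ℂ) *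
      ((((cuspSymbol f γ).im : ℝ) : ℂ) / (W.imaginaryPeriodRat : ℂ))) := by
  have hpP : p.Prime := hp.out
  have hp2 : p ≠ 2 := by rcases hp57 with rfl | rfl <;> norm_num
  have hp4 : ¬ p ∣ 4 := fun h ↦ by have := Nat.le_of_dvd four_pos h; rcases hp57 with rfl | rfl <;> omega
  -- `{∞, γ⁴∞} = 4 {∞, γ∞}`
  have h4 : cuspSymbol f (γ ^ 4) = 4 * cuspSymbol f γ := by
    have := map_pow (cuspSymbolHom f) γ 4
    simp only [cuspSymbolHom_apply] at this
    have h := congrArg Multiplicative.toAdd this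
    rw [toAdd_ofAdd, toAdd_pow, toAdd_ofAdd, nsmul_eq_mul, Nat.cast_ofNat] at h
    exact h
  have hcoe : ((γ ^ 4 : Gamma0 N) : SL(2, ℤ)) = (γ : SL(2, ℤ)) ^ 4 := rfl
  by_cases hc4 : ((γ ^ 4 : Gamma0 N) : SL(2, ℤ)) 1 0 = 0
  · -- `c(γ⁴) = 0`: the symbol vanishes
    have h0 : cuspSymbol f (γ ^ 4) = 0 := by simp only [cuspSymbol, hc4, if_true]
    rw [h4] at h0
    have : cuspSymbol f γ = 0 := by
      rcases mul_eq_zero.mp h0 with h | h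
      · norm_num at h
      · exact h
    rw [this, Complex.zero_im, Complex.ofReal_zero, zero_div]
    exact pint_of_isIntegral hpP isIntegral_zero
  · have h3 : 3 ∣ p - 1 → (3 : ℤ) ∣ ((γ ^ 4 : Gamma0 N) : SL(2, ℤ)) 1 0 →
        (3 : ℤ) ∣ ((γ ^ 4 : Gamma0 N) : SL(2, ℤ)) 1 1 - 1 := fun _ h ↦ by
      rw [hcoe] at h ⊢; exact three_dvd_pow_four_entry _ h
    have h4' : (4 : ℤ) ∣ ((γ ^ 4 : Gamma0 N) : SL(2, ℤ)) 1 0 →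
        (4 : ℤ) ∣ ((γ ^ 4 : Gamma0 N) : SL(2, ℤ)) 1 1 - 1 := fun h ↦ by
      rw [hcoe] at h ⊢; exact four_dvd_pow_four_entry _ h
    have hγc : (p : ℤ) ∣ (γ : SL(2, ℤ)) 1 0 := (Int.natCast_dvd_natCast.mpr hpN).trans (natCast_dvd_entry10 γ)
    have hd4p : ∃ d0 : ZMod p, d0 ≠ 0 ∧ ((((γ ^ 4 : Gamma0 N) : SL(2, ℤ)) 1 1 : ℤ) : ZMod p) = d0 ^ 4 :=
      pow_four_entry_eq_pow_four γ hpP hγc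
    -- the 57-splitting, with the EMPTY set of resonant primes
    obtain ⟨γ₁, γ₂, hmul, ⟨hc₁, hd₁, hr₁, h4₁⟩, ⟨hc₂, hd₂, hr₂, h4₂⟩, -, hsq₁, hsq₂⟩ :=
      exists_eq_mul_adjustable57 hpP hp57 hpN (γ ^ 4) hc4 hd4p h3 h4' ∅ (fun _ ↦ True)
        (fun _ h ↦ absurd h (Finset.notMem_empty _)) (fun _ h ↦ absurd h (Finset.notMem_empty _))
    have hP₁ := pint_im_cuspSymbol_of_adjustable_of_oddPrimeInstances hp2 f hf hpN hKodd γ₁ hc₁ hd₁ hr₁ h4₁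
      (Or.inr hsq₁)
    have hP₂ := pint_im_cuspSymbol_of_adjustable_of_oddPrimeInstances hp2 f hf hpN hKodd γ₂ hc₂ hd₂ hr₂ h4₂
      (Or.inr hsq₂)
    have hsum : cuspSymbol f γ₁ + cuspSymbol f γ₂ = 4 * cuspSymbol f γ := by
      rw [← h4, hmul, cuspSymbol_mul_holds f]
    have him : (((cuspSymbol f γ₁).im : ℝ) : ℂ) / (W.imaginaryPeriodRat : ℂ) +
        (((cuspSymbol f γ₂).im : ℝ) : ℂ) / (W.imaginaryPeriodRat : ℂ) =
        ((4 : ℕ) : ℂ) * ((((cuspSymbol f γ).im : ℝ) : ℂ) / (W.imaginaryPeriodRat : ℂ)) := by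
      have := congrArg Complex.im hsum
      rw [Complex.add_im] at this
      rw [← add_div, ← Complex.ofReal_add, this]
      simp [Complex.mul_im]
      ring
    refine pint_of_pint_natCast_mul hpP hp4 ?_
    rw [← him]
    exact pint_add hpP hP₁ hP₂

end Symbols

/-! ## Manin's `p`-part at a lattice-optimal datum -/

section Manin

variable {p : ℕ} [hp : Fact p.Prime]

/-- **`p ∤ c(D)` at a lattice-optimal datum, `p ∈ {5, 7}`, from the odd prime-modulus instances for `D.f` alone.**
Let `W/ℚ` be elliptic, `D` an `X₀(N)`-parametrisation datum whose pulled-back Néron lattice is `c · Λ_f`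
(lattice-optimal), `p ∈ {5, 7}` with `p ∣ N`. If for every prime `d′ > N` with `d′ ≡ 3 (mod 4)`, `p ∤ d′ − 1`,
`r ∤ d′ − 1` (odd primes `r ∣ p − 1`), `p` a square mod `d′`, and every ODD `χ (mod d′)`, the twisted symbol sum
`Σ_a χ(a){∞, a/d′}_{D.f} / (|Ω⁻(W)| i)` is `p`-integral, then `p ∤ c(D)`. Proof = seat manin-p1's `not_dvd_c_of_tameTwist57`
verbatim (`ϖ = m/|c|`, `m ∣ 2`; `Ω⁻_f / 2 = Im {∞, γ∞}_f` for some `γ`; `ord_p ϖ = −ord_p c`) over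
`pint_im_cuspSymbol_of_oddPrimeInstances57`. No named fact, no reduction-type, irreducibility or local-torsion
hypothesis. [cite: EdixhovenManin1991, §1] [cite: Manin1972, Prop. 1.4 / Thm. 1.6] -/
theorem not_dvd_c_of_oddPrimeInstances57 (hp57 : p = 5 ∨ p = 7)
    (W : WeierstrassCurve ℚ) [W.IsElliptic] {N : ℕ} [NeZero N]
    (D : ModularParametrizationData W N)
    (hopt : ∀ z ∈ D.L.lattice, ∃ w ∈ periodLattice D.f, z = D.c * w) (hpN : p ∣ N)
    (hKodd : ∀ (d' : ℕ) [NeZero d'], d'.Prime → N < d' → ¬ p ∣ d' - 1 →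
      (∀ r : ℕ, r.Prime → r ≠ 2 → r ∣ p - 1 → ¬ r ∣ d' - 1) → ¬ 4 ∣ d' - 1 →
      (7 < p ∨ IsSquare ((p : ZMod d'))) →
      ∀ χ : DirichletCharacter ℂ d', χ.Odd →
        ∃ s : ℕ, ¬ p ∣ s ∧ IsIntegral ℤ ((s : ℂ) *
          (twistedSymbolSum D.f χ / ((W.imaginaryPeriodRat : ℂ) * I)))) :
    ¬ (p : ℤ) ∣ D.c := by
  have hpP : p.Prime := hp.out
  have hp2 : p ≠ 2 := by rcases hp57 with rfl | rfl <;> norm_num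
  have hc0 : D.c ≠ 0 := D.maninConstant_ne_zero_holds
  -- the period scalar `ϖ = m/|c|`
  obtain ⟨mm, -, hmm⟩ :=
    SkinnerUrban2014.exists_dvd_two_mul_imaginaryPeriodRat_eq_of_latticeEq D hopt
  set ϖ : ℚ := (mm : ℚ) / |(D.c : ℚ)| with hϖdef
  have hϖ : (ϖ : ℝ) * W.imaginaryPeriodRat = minusPeriod D.f := by
    have habs0 : |(D.c : ℝ)| ≠ 0 := abs_ne_zero.mpr (by exact_mod_cast hc0)
    rw [hϖdef]; push_cast
    rw [div_mul_eq_mul_div, hmm]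
    field_simp
  have hΩf : 0 < minusPeriod D.f :=
    IsNewform0.minusPeriod_pos_holds D.isNewformOf.1 D.isNewformOf.coeffField_eq_bot
  have hΩ : 0 < W.imaginaryPeriodRat := W.imaginaryPeriodRat_pos
  -- `Ω⁻_f/2 = Im {∞, γ∞}_f` for some `γ`
  have hmem : minusPeriod D.f / 2 ∈ imagPeriods D.f := by
    rw [SkinnerUrban2014.imagPeriods_eq_zmultiples_of_minusPeriod_pos D.f hΩf]
    exact AddSubgroup.mem_zmultiples _
  obtain ⟨z, hz, hzim⟩ := AddSubgroup.mem_map.mp hmem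
  have hz' : z ∈ (periodLattice D.f : Set ℂ) := hz
  rw [coe_periodLattice_eq_range] at hz'
  obtain ⟨γ, hγ⟩ := hz'
  have hP := pint_im_cuspSymbol_of_oddPrimeInstances57 hp57 D.f D.isNewformOf hpN hKodd γ
  rw [hγ] at hP
  have hzim' : z.im = minusPeriod D.f / 2 := hzim
  -- `Im z / Ω = ϖ/2`
  have hq : (((z.im : ℝ) : ℂ) / (W.imaginaryPeriodRat : ℂ)) = ((ϖ / 2 : ℚ) : ℂ) := by
    rw [hzim', ← hϖ]
    have hΩ0 : (W.imaginaryPeriodRat : ℂ) ≠ 0 := by exact_mod_cast hΩ.ne'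
    push_cast
    field_simp
  rw [hq] at hP
  have hval := padicValRat_nonneg_of_pint hP
  have hϖ2 : padicValRat p (ϖ / 2) = padicValRat p ϖ := by
    have hϖ0 : ϖ ≠ 0 := by
      rintro h; rw [h, Rat.cast_zero, zero_mul] at hϖ; exact hΩf.ne' hϖ.symm
    rw [padicValRat.div hϖ0 two_ne_zero, show (2 : ℚ) = ((2 : ℕ) : ℚ) by norm_num, padicValRat.of_nat,
      padicValNat.eq_zero_of_not_dvd (fun h ↦ hp2 ((Nat.prime_dvd_prime_iff_eq hpP Nat.prime_two).mp h))]
    simp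
  rw [hϖ2, ManinFrameResidueProperRUnitTwist.padicValRat_eq_neg_of_mul_imaginaryPeriodRat_eq hp2 D hopt hϖ]
    at hval
  exact not_dvd_of_padicValRat_intCast_le_zero hc0 (by linarith)

end Manin

end Summit.BirchSwinnertonDyer.BirchSwinnertonDyer.Theorems.BiquadraticEisensteinDescentManinDatumSupercuspidalCMInertPointwiseLever

end
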